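import Mathlib
import Summits.NavierStokesRegularity.NavierStokesRegularity.Theorems.ThreadingFluxHorizonTowerFiniteTowerDefs
import Summits.NavierStokesRegularity.NavierStokesRegularity.Theorems.ThreadingFluxHorizonTowerFiniteTowerZonality
import HarnessLib

/-!
# Crux `PoloidalLiouville` (stmt-NavierStokesRegularity-1222), crux idea «horizon-threading-tower» (ns-idea-15):
# `FiniteTowerZonalTopHorizonTowerZonality` and `FiniteTowerCoprimeTopHorizonTowerZonality` BY NAME

Support file (`--supports stmt-NavierStokesRegularity-1222`, helper; cell `ns-wall-extremal`, width hand ns-wall-eng-3 g4; 0 kit).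
The typed statements (`Theorems/ThreadingFluxHorizonTowerFiniteTowerDefs.lean`, statements-only companion of the Defs twin, typed at
ns-wall-crit-1 g5's price P4) are closed by name from `finiteTower_zonalForm_of_zonalTop` / `finiteTower_zonalForm_of_coprime` (`…FiniteTowerZonality`): the
Defs-shaped binders (`D := K.max'`, `D′ := (K.erase D).max'`, the zonal FUNCTIONAL FORM of the top shell) are unfolded into the
working binders (`D ∈ K` maximal, `D′` second largest, infinitesimal zonality via `inner_cross_gradient_eq_zero_of_zonalForm`).

HONEST LABEL: special-case theorems of the crux-idea conjecture `HorizonTowerZonality` (finite towers + a side condition on the top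
shells); general finite towers, general towers, `PoloidalLiouville` (1222) OPEN; W1 movement 0; NS regularity NOT proved.
-/

-- the summit and its single sub-problem share the name (CONVENTIONS §1)
set_option linter.dupNamespace false

noncomputable section

namespace Summit.NavierStokesRegularity.NavierStokesRegularity.Theorems.PoloidalLiouville.HorizonTower

open scoped RealInnerProductSpace Polynomial
open Literature.Analysis.FluidPDE (cross)
open MvPolynomial

/-- ★★ `FiniteTowerZonalTopHorizonTowerZonality` BY NAME (THM A, zonal-top descent). -/
theorem finiteTowerZonalTopHorizonTowerZonality : FiniteTowerZonalTopHorizonTowerZonality := by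
  intro K H hK a hK1 hH hhom hharm hD0 ha htop hL1
  have hD : K.max' hK ∈ K := Finset.max'_mem K hK
  have hmax : ∀ l ∈ K, l ≤ K.max' hK := fun l hl => Finset.le_max' K l hl
  obtain ⟨g, hg⟩ := htop
  have htop' : ∀ y : E3, ⟪cross a y, gradient (H (K.max' hK)) y⟫ = 0 :=
    inner_cross_gradient_eq_zero_of_zonalForm (l := K.max' hK) ha ((hH _ hD).differentiable (by simp)) hg
  exact finiteTower_zonalForm_of_zonalTop K H hK1 hH hhom hharm hL1 hD hmax hD0 ha htop'

/-- ★★ `FiniteTowerCoprimeTopHorizonTowerZonality` BY NAME (THM B, coprime top pair). -/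
theorem finiteTowerCoprimeTopHorizonTowerZonality : FiniteTowerCoprimeTopHorizonTowerZonality := by
  intro K H hK hK' hK1 hH hhom hharm hD0 hD'0 hcop hL1
  set D := K.max' hK with hDdef
  set D' := (K.erase D).max' hK' with hD'def
  have hD : D ∈ K := Finset.max'_mem K hK
  have hmax : ∀ l ∈ K, l ≤ D := fun l hl => Finset.le_max' K l hl
  have hD'e : D' ∈ K.erase D := Finset.max'_mem _ hK'
  have hD' : D' ∈ K := Finset.mem_of_mem_erase hD'e
  have hlt : D' < D := lt_of_le_of_ne (hmax D' hD') (Finset.ne_of_mem_erase hD'e)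
  have hsec : ∀ l ∈ K, l ≠ D → l ≤ D' := fun l hl hne => Finset.le_max' _ l (Finset.mem_erase.mpr ⟨hne, hl⟩)
  exact finiteTower_zonalForm_of_coprime K H hK1 hH hhom hharm hL1 hD hD' hlt hmax hsec hcop.symm hD0 hD'0

/-! ### A companion: a zonal SECOND shell also decides the tower -/

/-- **Zonal second shell ⇒ zonal top shell** (polynomial level): in a finite tower passing order one, if the second largest shell
`P_{D′} ≠ 0` is annihilated by the rotation derivative about the real axis `n ≠ 0`, then so is the top shell `P_D`
(the top pair is isolated: `D′·f·g′ = D·g·f′` with `f = α q^{D′}` forces `g = γ q^D`). [folklore] -/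
theorem finiteTower_top_detP_lin_eq_zero_of_second (K : Finset ℕ) (H : ℕ → E3 → ℝ) (hK : ∀ l ∈ K, 1 ≤ l)
    (hH : ∀ l ∈ K, ContDiff ℝ (⊤ : ℕ∞) (H l)) (hhom : ∀ l ∈ K, ∀ (c : ℝ) (y : E3), H l (c • y) = c ^ l * H l y)
    (hharm : ∀ l ∈ K, ∀ y, Laplacian.laplacian (H l) y = 0)
    (hL1 : ∀ x : E3, x ≠ 0 → horizonL1 (fun z => ∑ l ∈ K, horizonProfile l (H l) 0 z) 0 x = 0)
    (P : ℕ → MvPolynomial (Fin 3) ℝ)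
    (hP : ∀ l ∈ K, (P l).IsHomogeneous l ∧ Zonal.lapP (P l) = 0 ∧ ∀ y, H l y = Zonal.evalE (P l) y)
    {D D' : ℕ} (hD : D ∈ K) (hD' : D' ∈ K) (hlt : D' < D) (hmax : ∀ l ∈ K, l ≤ D) (hsec : ∀ l ∈ K, l ≠ D → l ≤ D')
    (hPD' : P D' ≠ 0) {n : Fin 3 → ℝ} (hn : n ≠ 0)
    (hsecond : Zonal.detP (MvPolynomial.C (n 0) * MvPolynomial.X 0 + MvPolynomial.C (n 1) * MvPolynomial.X 1
      + MvPolynomial.C (n 2) * MvPolynomial.X 2) (P D') = 0) :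
    Zonal.detP (MvPolynomial.C (n 0) * MvPolynomial.X 0 + MvPolynomial.C (n 1) * MvPolynomial.X 1
      + MvPolynomial.C (n 2) * MvPolynomial.X 2) (P D) = 0 := by
  set a : Fin 3 → ℂ := fun i => ((n i : ℝ) : ℂ) with ha'
  have ha : a ≠ 0 := ofReal_axis_ne_zero hn
  have hlin : map (algebraMap ℝ ℂ) (C (n 0) * X 0 + C (n 1) * X 1 + C (n 2) * X 2 : MvPolynomial (Fin 3) ℝ)
      = C (a 0) * X 0 + C (a 1) * X 1 + C (a 2) * X 2 := map_lin n
  set f : Polynomial ℂ := Zonal.chartT (map (algebraMap ℝ ℂ) (P D')) with hf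
  set g : Polynomial ℂ := Zonal.chartT (map (algebraMap ℝ ℂ) (P D)) with hg
  set q : Polynomial ℂ := Zonal.chartT (C (a 0) * X 0 + C (a 1) * X 1 + C (a 2) * X 2) with hq
  have hq0 : q ≠ 0 := fun h => ha (Zonal.lin_eq_zero_of_chartT_eq_zero h)
  have hrotD' : Zonal.detP (C (a 0) * X 0 + C (a 1) * X 1 + C (a 2) * X 2) (map (algebraMap ℝ ℂ) (P D')) = 0 := by
    rw [← hlin, ← Zonal.map_detP, hsecond, map_zero]
  obtain ⟨α, hα⟩ := Zonal.exists_chartT_eq_C_mul_pow_of_detP_lin_eq_zero (((hP D' hD').1).map (algebraMap ℝ ℂ)) (hK D' hD')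
    ha hrotD'
  -- the top pair is isolated: `D′ f g′ = D g f′`, hence `W(f^D, g^{D′}) = 0`
  have hW := finiteTower_top_wronskian K H hK hH hhom hharm hL1 P (fun l hl => ⟨(hP l hl).1, (hP l hl).2.2⟩) hD hD' hlt hmax hsec
  have hWr := Zonal.wronskian_pow_pow_eq_zero (hK D' hD') (hK D hD) hW
  have hf0 : f ≠ 0 := fun h => hPD' (Zonal.eq_zero_of_chartT_map_eq_zero (hP D' hD').1 (hP D' hD').2.1 h)
  -- `g^{D′} = c · f^{D} = (c α^D) · (q^D)^{D′}`
  rw [← Polynomial.wronskian_neg_eq, neg_eq_zero] at hWr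
  obtain ⟨c, hc⟩ := Zonal.exists_C_mul_of_wronskian_eq_zero (pow_ne_zero _ hf0) hWr
  have hgD : g ^ D' = Polynomial.C (c * α ^ D) * (q ^ D) ^ D' := by
    rw [hc]
    change Polynomial.C c * f ^ D = _
    rw [show f = Polynomial.C α * q ^ D' from hα, mul_pow, ← Polynomial.C_pow, ← mul_assoc, ← Polynomial.C_mul, ← pow_mul,
      ← pow_mul, mul_comm D' D]
  obtain ⟨γ, hγ⟩ := Zonal.exists_eq_C_mul_pow_of_pow_eq (hK D' hD') hq0 hgD
  have hzon := Zonal.detP_lin_eq_zero_of_chartT_eq (((hP D hD).1).map (algebraMap ℝ ℂ)) (hK D hD)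
    (by rw [← Zonal.map_lapP, (hP D hD).2.1, map_zero]) a hγ
  rwa [← hlin, ← Zonal.map_detP, map_eq_zero_iff _ (map_injective (algebraMap ℝ ℂ) (RCLike.ofReal_injective))] at hzon

/-- ★ **THM A′ — ZONAL SECOND SHELL.**  In a finite scale-free tower of horizon profiles passing order one, if the SECOND largest shell
`H_{D′} ≢ 0` is infinitesimally zonal about `a ≠ 0` and the top shell `H_D ≢ 0`, then every shell is zonal about `a`
(the top pair is isolated, so the top shell inherits the axis; then THM A). [folklore] -/
theorem finiteTower_zonal_of_zonalSecond (K : Finset ℕ) (H : ℕ → E3 → ℝ) (hK : ∀ l ∈ K, 1 ≤ l)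
    (hH : ∀ l ∈ K, ContDiff ℝ (⊤ : ℕ∞) (H l)) (hhom : ∀ l ∈ K, ∀ (c : ℝ) (y : E3), H l (c • y) = c ^ l * H l y)
    (hharm : ∀ l ∈ K, ∀ y, Laplacian.laplacian (H l) y = 0)
    (hL1 : ∀ x : E3, x ≠ 0 → horizonL1 (fun z => ∑ l ∈ K, horizonProfile l (H l) 0 z) 0 x = 0)
    {D D' : ℕ} (hD : D ∈ K) (hD' : D' ∈ K) (hlt : D' < D) (hmax : ∀ l ∈ K, l ≤ D) (hsec : ∀ l ∈ K, l ≠ D → l ≤ D')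
    (hD0 : ∃ y, H D y ≠ 0) (hD'0 : ∃ y, H D' y ≠ 0)
    {a : E3} (ha : a ≠ 0) (hsecond : ∀ y : E3, ⟪cross a y, gradient (H D') y⟫ = 0) :
    ∀ l ∈ K, ∀ y : E3, ⟪cross a y, gradient (H l) y⟫ = 0 := by
  obtain ⟨P, hP⟩ := finiteTower_exists_polys K H hH hhom hharm
  have hne : ∀ {l}, l ∈ K → (∃ y, H l y ≠ 0) → P l ≠ 0 := by
    intro l hl ⟨y, hy⟩ h
    apply hy
    rw [(hP l hl).2.2 y, h]
    simp [Zonal.evalE]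
  set n : Fin 3 → ℝ := fun i => a i with hn'
  have han : (WithLp.toLp 2 n : E3) = a := by ext i; simp [hn']
  have hn : n ≠ 0 := by
    intro h
    apply ha
    rw [← han, h]
    rfl
  have hsecond' : Zonal.detP (MvPolynomial.C (n 0) * MvPolynomial.X 0 + MvPolynomial.C (n 1) * MvPolynomial.X 1
      + MvPolynomial.C (n 2) * MvPolynomial.X 2) (P D') = 0 := by
    rw [Zonal.detP_lin_eq_zero_iff]
    intro y
    rw [han, ← show H D' = Zonal.evalE (P D') from funext (hP D' hD').2.2]
    exact hsecond y
  have htop := finiteTower_top_detP_lin_eq_zero_of_second K H hK hH hhom hharm hL1 P hP hD hD' hlt hmax hsec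
    (hne hD' hD'0) hn hsecond'
  intro l hl y
  have h := finiteTower_detP_lin_eq_zero_of_top K H hK hH hhom hharm hL1 P hP hD hmax (hne hD hD0) hn htop l hl
  rw [Zonal.detP_lin_eq_zero_iff] at h
  have := h y
  rwa [han, ← show H l = Zonal.evalE (P l) from funext (hP l hl).2.2] at this

end Summit.NavierStokesRegularity.NavierStokesRegularity.Theorems.PoloidalLiouville.HorizonTower

end
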